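import Summits.Ventures.PercRepro.Night2FatZCross

/-!
# night-2: the two-planes regime — two points in each plane off the spine close `N ≥ 8`

In the non-degenerate two-planes regime every target containing a cross pair is unloaded
(`dload_eq_zero_of_cross_pair`); with two points of `W ∖ {x}` in each plane off the spine the `k`-subsets of `W ∖ {x}`
containing a cross pair number at least `C(m, k) − 2·C(m − 2, k) + C(m − 4, k)` (`choose_le_card_filter_meets_both`),
a second difference of binomials that is nonnegative (`two_mul_choose_le_choose_add_choose`) and increasing in `m`
(`choose_add_le_choose_add_cross`).  At `m = 7` (`N = 8`) the levels `1, 3, …, 8` give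
`110/221 + (110/221)(4/15 + 16/35 + 25/70 + 19/126 + 7/210 + 1/330) = 1.128` (`fat_count_numeric_cross_large`), so
**`basis_pair_fair_fat_of_two_planes_of_eight_le`** holds for every `N ≥ 8` — no hypothesis on the spine.
Paper `proofs/NIGHT-2-g34.md` §6 (c).
-/

namespace PercRepro.Shadow

open PercRepro.ThmH PercRepro.PerFlat

variable {α : Type*} [DecidableEq α] {M : Matroid α} [M.Finite] {G : Finset α}

omit [DecidableEq α] in
/-- The second difference of the binomial coefficients is nonnegative: `2·C(m − 2, j) ≤ C(m, j) + C(m − 4, j)`. -/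
theorem two_mul_choose_le_choose_add_choose (m : ℕ) (hm : 4 ≤ m) (j : ℕ) :
    2 * (m - 2).choose j ≤ m.choose j + (m - 4).choose j := by
  rcases j with _ | j
  · simp
  · obtain ⟨n, rfl⟩ : ∃ n, m = n + 4 := ⟨m - 4, by omega⟩
    have e1 : (n + 4).choose (j + 1) = (n + 3).choose j + (n + 3).choose (j + 1) := Nat.choose_succ_succ' (n + 3) j
    have e2 : (n + 3).choose (j + 1) = (n + 2).choose j + (n + 2).choose (j + 1) := Nat.choose_succ_succ' (n + 2) j
    have e3 : (n + 2).choose (j + 1) = (n + 1).choose j + (n + 1).choose (j + 1) := Nat.choose_succ_succ' (n + 1) j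
    have e4 : (n + 1).choose (j + 1) = n.choose j + n.choose (j + 1) := Nat.choose_succ_succ' n j
    have h1 : (n + 1).choose j ≤ (n + 3).choose j := Nat.choose_le_choose j (by omega)
    have h2 : n.choose j ≤ (n + 2).choose j := Nat.choose_le_choose j (by omega)
    rw [show n + 4 - 2 = n + 2 by omega, show n + 4 - 4 = n by omega]
    omega

omit [DecidableEq α] in
/-- The second difference `C(m, k) − 2·C(m − 2, k) + C(m − 4, k)` is increasing in `m`: for `m ≥ 7`,
`C(7, k) + C(3, k) + 2·C(m − 2, k) ≤ C(m, k) + C(m − 4, k) + 2·C(5, k)`. -/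
theorem choose_add_le_choose_add_cross (m : ℕ) (hm : 7 ≤ m) (k : ℕ) :
    (7 : ℕ).choose k + (3 : ℕ).choose k + 2 * (m - 2).choose k ≤ m.choose k + (m - 4).choose k + 2 * (5 : ℕ).choose k := by
  induction m, hm using Nat.le_induction generalizing k with
  | base => simp
  | succ m hm ih =>
    rcases k with _ | k
    · simp
    · have h1 := ih (k + 1)
      have h2 := two_mul_choose_le_choose_add_choose m (by omega) k
      have e1 : (m + 1).choose (k + 1) = m.choose k + m.choose (k + 1) := Nat.choose_succ_succ' m k
      have e2 : (m + 1 - 2).choose (k + 1) = (m - 2).choose k + (m - 2).choose (k + 1) := by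
        rw [show m + 1 - 2 = m - 2 + 1 by omega]
        exact Nat.choose_succ_succ' (m - 2) k
      have e3 : (m + 1 - 4).choose (k + 1) = (m - 4).choose k + (m - 4).choose (k + 1) := by
        rw [show m + 1 - 4 = m - 4 + 1 by omega]
        exact Nat.choose_succ_succ' (m - 4) k
      omega

/-- **The numerics of `N ≥ 8` from the cross-containing targets**: with `s_k ≥ C(m, k) − 2·C(m − 2, k) + C(m − 4, k)`
for `k = 1, …, 7` and `m ≥ 7`, the levels `1, 3, …, 8` exceed `1` (`1.128` at `m = 7`). -/
theorem fat_count_numeric_cross_large (m : ℕ) (hm : 7 ≤ m) (s₂ s₃ s₄ s₅ s₆ s₇ : ℕ)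
    (h₂ : m.choose 2 + (m - 4).choose 2 ≤ s₂ + 2 * (m - 2).choose 2)
    (h₃ : m.choose 3 + (m - 4).choose 3 ≤ s₃ + 2 * (m - 2).choose 3)
    (h₄ : m.choose 4 + (m - 4).choose 4 ≤ s₄ + 2 * (m - 2).choose 4)
    (h₅ : m.choose 5 + (m - 4).choose 5 ≤ s₅ + 2 * (m - 2).choose 5)
    (h₆ : m.choose 6 + (m - 4).choose 6 ≤ s₆ + 2 * (m - 2).choose 6)
    (h₇ : m.choose 7 + (m - 4).choose 7 ≤ s₇ + 2 * (m - 2).choose 7) :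
    (1 : ℚ) ≤ fatTerm 1 (11 / 18) + ((s₂ : ℚ) * fatTerm 3 (11 / 18) + (s₃ : ℚ) * fatTerm 4 (11 / 18) +
      (s₄ : ℚ) * fatTerm 5 (11 / 18) + (s₅ : ℚ) * fatTerm 6 (11 / 18) + (s₆ : ℚ) * fatTerm 7 (11 / 18) +
      (s₇ : ℚ) * fatTerm 8 (11 / 18)) := by
  have b₂ := choose_add_le_choose_add_cross m hm 2
  have b₃ := choose_add_le_choose_add_cross m hm 3
  have b₄ := choose_add_le_choose_add_cross m hm 4
  have b₅ := choose_add_le_choose_add_cross m hm 5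
  have b₆ := choose_add_le_choose_add_cross m hm 6
  have b₇ := choose_add_le_choose_add_cross m hm 7
  simp only [Nat.choose] at b₂ b₃ b₄ b₅ b₆ b₇
  have l₂ : 4 ≤ s₂ := by omega
  have l₃ : 16 ≤ s₃ := by omega
  have l₄ : 25 ≤ s₄ := by omega
  have l₅ : 19 ≤ s₅ := by omega
  have l₆ : 7 ≤ s₆ := by omega
  have l₇ : 1 ≤ s₇ := by omega
  have q₂ : (4 : ℚ) ≤ s₂ := by exact_mod_cast l₂
  have q₃ : (16 : ℚ) ≤ s₃ := by exact_mod_cast l₃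
  have q₄ : (25 : ℚ) ≤ s₄ := by exact_mod_cast l₄
  have q₅ : (19 : ℚ) ≤ s₅ := by exact_mod_cast l₅
  have q₆ : (7 : ℚ) ≤ s₆ := by exact_mod_cast l₆
  have q₇ : (1 : ℚ) ≤ s₇ := by exact_mod_cast l₇
  have p₃ : (0 : ℚ) ≤ fatTerm 3 (11 / 18) := by unfold fatTerm; positivity
  have p₄ : (0 : ℚ) ≤ fatTerm 4 (11 / 18) := by unfold fatTerm; positivity
  have p₅ : (0 : ℚ) ≤ fatTerm 5 (11 / 18) := by unfold fatTerm; positivity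
  have p₆ : (0 : ℚ) ≤ fatTerm 6 (11 / 18) := by unfold fatTerm; positivity
  have p₇ : (0 : ℚ) ≤ fatTerm 7 (11 / 18) := by unfold fatTerm; positivity
  have p₈ : (0 : ℚ) ≤ fatTerm 8 (11 / 18) := by unfold fatTerm; positivity
  have hnum : (1 : ℚ) ≤ fatTerm 1 (11 / 18) + (4 * fatTerm 3 (11 / 18) + 16 * fatTerm 4 (11 / 18) +
      25 * fatTerm 5 (11 / 18) + 19 * fatTerm 6 (11 / 18) + 7 * fatTerm 7 (11 / 18) + 1 * fatTerm 8 (11 / 18)) := by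
    unfold fatTerm
    norm_num [Nat.choose]
  nlinarith [mul_le_mul_of_nonneg_right q₂ p₃, mul_le_mul_of_nonneg_right q₃ p₄, mul_le_mul_of_nonneg_right q₄ p₅,
    mul_le_mul_of_nonneg_right q₅ p₆, mul_le_mul_of_nonneg_right q₆ p₇, mul_le_mul_of_nonneg_right q₇ p₈]

omit [DecidableEq α] in
/-- `fatTerm` is monotone in the capacity. -/
theorem fatTerm_le_fatTerm_if (j N : ℕ) :
    fatTerm j (11 / 18) ≤ fatTerm j (if N - j ≤ 3 then 1 else 11 / 18) := by
  unfold fatTerm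
  split_ifs
  · apply div_le_div_of_nonneg_right (by norm_num) (by positivity)
  · exact le_rfl

/-- **The fat case of (FAIR) in the non-degenerate two-planes regime for `N ≥ 8` from two points of `W ∖ {x}` in each
plane off the spine** — no hypothesis on the spine. -/
theorem basis_pair_fair_fat_of_two_planes_of_eight_le (hG : G ∈ flatsQ M (5 + 1)) (hd : (gr M \ G).card = 2)
    (hk : kColoops M G = 1) (hs : ∀ e ∈ gr M, ∀ f ∈ gr M, e ≠ f → rkN M {e, f} = 2)
    (hl : ∀ e ∈ gr M, M.Indep {e}) (hfat : (fatClosures M 5 G 2).card ≤ 1)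
    {B₀ : Finset α} (hB₀ : B₀ ∈ thinMembers M 5 G) {w₀ x : α} (hD : G \ clF M B₀ = {w₀, x}) (hne : w₀ ≠ x) {R₁ : Finset α}
    (hR₁V : R₁ ⊆ (G \ coloops M G) \ {w₀, x}) (hR₁2 : rkN M R₁ = 2) (hR₁3 : 3 ≤ R₁.card) {c₂ c₃ : α}
    (hc₂V : c₂ ∈ (G \ coloops M G) \ {w₀, x}) (hc₃V : c₃ ∈ (G \ coloops M G) \ {w₀, x})
    (hc₂ : c₂ ∉ clF M R₁) (hc₃ : c₃ ∉ clF M (insert c₂ R₁))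
    (hcover : ∀ e ∈ (G \ coloops M G) \ {w₀, x}, e ∈ clF M (insert c₂ R₁) ∨ e ∈ clF M (insert c₃ R₁))
    (hnd₂ : 3 ≤ rkN M (((G \ coloops M G) \ {w₀, x}).filter
      (fun e => e ∈ clF M (insert c₂ R₁) ∧ e ∉ clF M R₁)))
    (hnd₃ : 3 ≤ rkN M (((G \ coloops M G) \ {w₀, x}).filter
      (fun e => e ∈ clF M (insert c₃ R₁) ∧ e ∉ clF M R₁)))
    {B : Finset α} (hB : B ∈ thinMembers M 5 G) (hnP : ¬ bigP M G B) {z : α} (hz : z ∈ G \ clF M B)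
    (hl0 : loss M 5 G B z ≠ 0) (hw₀ : w₀ ∈ insert z B) (hx : x ∉ insert z B) (hN : 8 ≤ (G \ insert z B).card)
    {y₂ y₂' y₃ y₃' : α} (hy₂ : y₂ ∈ (G \ insert z B).erase x) (hy₂' : y₂' ∈ (G \ insert z B).erase x)
    (hy₃ : y₃ ∈ (G \ insert z B).erase x) (hy₃' : y₃' ∈ (G \ insert z B).erase x)
    (hne₂ : y₂ ≠ y₂') (hne₃ : y₃ ≠ y₃')
    (hy₂2 : y₂ ∈ clF M (insert c₂ R₁)) (hy₂L : y₂ ∉ clF M R₁) (hy₂'2 : y₂' ∈ clF M (insert c₂ R₁))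
    (hy₂'L : y₂' ∉ clF M R₁) (hy₃3 : y₃ ∈ clF M (insert c₃ R₁)) (hy₃L : y₃ ∉ clF M R₁)
    (hy₃'3 : y₃' ∈ clF M (insert c₃ R₁)) (hy₃'L : y₃' ∉ clF M R₁) :
    loss M 5 G B z ≤ rhoL M 5 G B z * lossIncomeH M 5 G (bigP M G) (dshGT2 M 5 G) B z := by
  have hd' : (gr M \ G).card ≤ 5 := by omega
  have hGg : G ⊆ gr M := (mem_flatsQ.1 hG).1
  have hxG : x ∈ G \ insert z B := by
    refine Finset.mem_sdiff.2 ⟨?_, hx⟩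
    have : x ∈ G \ clF M B₀ := by
      rw [hD]
      exact Finset.mem_insert_of_mem (Finset.mem_singleton_self _)
    exact (Finset.mem_sdiff.1 this).1
  set W' := (G \ insert z B).erase x with hW'
  set A := W'.filter (fun e => e ∈ clF M (insert c₂ R₁) ∧ e ∉ clF M R₁) with hA'
  set Bp := W'.filter (fun e => e ∈ clF M (insert c₃ R₁) ∧ e ∉ clF M R₁) with hBp'
  have hm : W'.card + 1 = (G \ insert z B).card := by
    rw [hW', Finset.card_erase_of_mem hxG]
    have : 0 < (G \ insert z B).card := by omega
    omega
  have hR₁g : R₁ ⊆ gr M := hR₁V.trans (fun e he => hGg (Finset.mem_sdiff.1 (Finset.mem_sdiff.1 he).1).1)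
  have hc₂g : c₂ ∈ gr M := hGg (Finset.mem_sdiff.1 (Finset.mem_sdiff.1 hc₂V).1).1
  have hc₃g : c₃ ∈ gr M := hGg (Finset.mem_sdiff.1 (Finset.mem_sdiff.1 hc₃V).1).1
  -- the two explicit pairs inside the planes' point sets
  set A' : Finset α := {y₂, y₂'} with hA'd
  set B' : Finset α := {y₃, y₃'} with hB'd
  have hA'A : A' ⊆ A := by
    intro e he
    rw [hA'd, Finset.mem_insert, Finset.mem_singleton] at he
    rw [hA', Finset.mem_filter]
    rcases he with rfl | rfl
    · exact ⟨hy₂, hy₂2, hy₂L⟩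
    · exact ⟨hy₂', hy₂'2, hy₂'L⟩
  have hB'B : B' ⊆ Bp := by
    intro e he
    rw [hB'd, Finset.mem_insert, Finset.mem_singleton] at he
    rw [hBp', Finset.mem_filter]
    rcases he with rfl | rfl
    · exact ⟨hy₃, hy₃3, hy₃L⟩
    · exact ⟨hy₃', hy₃'3, hy₃'L⟩
  have hA'W : A' ⊆ W' := hA'A.trans (Finset.filter_subset _ _)
  have hB'W : B' ⊆ W' := hB'B.trans (Finset.filter_subset _ _)
  have hdisj : Disjoint A' B' := by
    rw [Finset.disjoint_left]
    intro e heA heB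
    have h1 := (Finset.mem_filter.1 (hA'A heA)).2
    have h2 := (Finset.mem_filter.1 (hB'B heB)).2
    exact h1.2 (mem_clF_of_mem_two_planes hR₁g hc₂g hc₃g hc₂ hc₃ h1.1 h2.1)
  have hcA' : A'.card = 2 := Finset.card_pair hne₂
  have hcB' : B'.card = 2 := Finset.card_pair hne₃
  have hcWA : (W' \ A').card = W'.card - 2 := by rw [Finset.card_sdiff_of_subset hA'W, hcA']
  have hcWB : (W' \ B').card = W'.card - 2 := by rw [Finset.card_sdiff_of_subset hB'W, hcB']
  have hcWAB : (W' \ (A' ∪ B')).card = W'.card - 4 := by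
    rw [Finset.card_sdiff_of_subset (Finset.union_subset hA'W hB'W), Finset.card_union_of_disjoint hdisj, hcA', hcB']
  -- the count for the full point sets dominates the count for the explicit pairs
  have hmono : ∀ k, ((W'.powersetCard k).filter (fun Y => (Y ∩ A').Nonempty ∧ (Y ∩ B').Nonempty)).card ≤
      ((W'.powersetCard k).filter (fun Y => (Y ∩ A).Nonempty ∧ (Y ∩ Bp).Nonempty)).card := by
    intro k
    apply Finset.card_le_card
    intro Y hY
    rw [Finset.mem_filter] at hY ⊢
    exact ⟨hY.1, Finset.Nonempty.mono (Finset.inter_subset_inter (Finset.Subset.refl _) hA'A) hY.2.1,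
      Finset.Nonempty.mono (Finset.inter_subset_inter (Finset.Subset.refl _) hB'B) hY.2.2⟩
  have hcount : ∀ k, W'.card.choose k + (W'.card - 4).choose k ≤
      ((W'.powersetCard k).filter (fun Y => (Y ∩ A).Nonempty ∧ (Y ∩ Bp).Nonempty)).card +
        2 * (W'.card - 2).choose k := by
    intro k
    have := choose_le_card_filter_meets_both W' A' B' k
    rw [hcWA, hcWB, hcWAB] at this
    have := hmono k
    omega
  -- the level bounds with the capacity `11/18`
  have hlev : ∀ j, 1 ≤ j → (((W'.powersetCard (j - 1)).filter
      (fun Y => (Y ∩ A).Nonempty ∧ (Y ∩ Bp).Nonempty)).card : ℚ) * fatTerm j (11 / 18) ≤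
      ∑ T ∈ ((tgtSets M 5 G B z).filter
        (fun T => x ∈ T ∧ dload M 5 G (bigP M G) (dshGT2 M 5 G) T = 0)).filter
        (fun T => (T \ insert z B).card = j),
        capS M 5 G T / ((221 / 360 : ℚ) * ((2 * ((T \ coloops M G).card - 2).choose 4 : ℕ) : ℚ)) := by
    intro j hj
    have h := fat_count_level_ge_cross hG hd hk hs hl hfat hB₀ hD hR₁V hR₁2 hR₁3 hc₂V hc₃V hc₂ hc₃ hcover hnd₂ hnd₃
      hB hnP hz hxG hj
    rw [← hW', ← hA', ← hBp'] at h
    refine le_trans (mul_le_mul_of_nonneg_left (fatTerm_le_fatTerm_if j (G \ insert z B).card) (by positivity)) h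
  have hl1 := fat_count_level_ge' hG hd hk hB hnP hz hxG (j := 1) (by norm_num)
    (fun T hT _ h1 => dload_eq_zero_of_card_sdiff_le_six hG hd hk hs hl
      (by rw [card_sdiff_coloops_eq_level_add_five hG hd hk hB hnP hz hT, h1]))
  have hc1 : (if (G \ insert z B).card - 1 ≤ 3 then (1 : ℚ) else 11 / 18) = 11 / 18 := by
    rw [if_neg (by omega)]
  rw [hc1] at hl1
  simp only [Nat.sub_self, Nat.choose_zero_right, Nat.cast_one, one_mul] at hl1
  have hl3 := hlev 3 (by norm_num)
  have hl4 := hlev 4 (by norm_num)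
  have hl5 := hlev 5 (by norm_num)
  have hl6 := hlev 6 (by norm_num)
  have hl7 := hlev 7 (by norm_num)
  have hl8 := hlev 8 (by norm_num)
  simp only [show (3 : ℕ) - 1 = 2 from rfl] at hl3
  simp only [show (4 : ℕ) - 1 = 3 from rfl] at hl4
  simp only [show (5 : ℕ) - 1 = 4 from rfl] at hl5
  simp only [show (6 : ℕ) - 1 = 5 from rfl] at hl6
  simp only [show (7 : ℕ) - 1 = 6 from rfl] at hl7
  simp only [show (8 : ℕ) - 1 = 7 from rfl] at hl8
  set s₂ := ((W'.powersetCard 2).filter (fun Y => (Y ∩ A).Nonempty ∧ (Y ∩ Bp).Nonempty)).card with hs₂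
  set s₃ := ((W'.powersetCard 3).filter (fun Y => (Y ∩ A).Nonempty ∧ (Y ∩ Bp).Nonempty)).card with hs₃
  set s₄ := ((W'.powersetCard 4).filter (fun Y => (Y ∩ A).Nonempty ∧ (Y ∩ Bp).Nonempty)).card with hs₄
  set s₅ := ((W'.powersetCard 5).filter (fun Y => (Y ∩ A).Nonempty ∧ (Y ∩ Bp).Nonempty)).card with hs₅
  set s₆ := ((W'.powersetCard 6).filter (fun Y => (Y ∩ A).Nonempty ∧ (Y ∩ Bp).Nonempty)).card with hs₆
  set s₇ := ((W'.powersetCard 7).filter (fun Y => (Y ∩ A).Nonempty ∧ (Y ∩ Bp).Nonempty)).card with hs₇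
  have hnum := fat_count_numeric_cross_large W'.card (by omega) s₂ s₃ s₄ s₅ s₆ s₇
    (hcount 2) (hcount 3) (hcount 4) (hcount 5) (hcount 6) (hcount 7)
  have hg0 : ∀ T ∈ (tgtSets M 5 G B z).filter
      (fun T => x ∈ T ∧ dload M 5 G (bigP M G) (dshGT2 M 5 G) T = 0),
      0 ≤ capS M 5 G T / ((221 / 360 : ℚ) * ((2 * ((T \ coloops M G).card - 2).choose 4 : ℕ) : ℚ)) :=
    fun T _ => div_nonneg (capS_nonneg' hG hd' T) (by positivity)
  apply basis_pair_fair_of_fat_count_sum hG hd hk hs hl hfat hB₀ hD hne hB hnP hz hl0 hw₀ hx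
  have hsum := sum_levels_le_sum hg0 (fun T => (T \ insert z B).card) {1, 3, 4, 5, 6, 7, 8}
  rw [Finset.sum_insert (by decide), Finset.sum_insert (by decide), Finset.sum_insert (by decide),
    Finset.sum_insert (by decide), Finset.sum_insert (by decide), Finset.sum_insert (by decide),
    Finset.sum_singleton] at hsum
  linarith

end PercRepro.Shadow
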